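import Mathlib.Topology.Algebra.Category.ProfiniteGrp.Completion
import Literature.AnabelianGeometry.AbsoluteAnabelian.AbsTopIII.CurveModel
import Literature.AnabelianGeometry.AbsoluteAnabelian.AbsTopIII.KummerFaithful
import HarnessLib

/-!
# [AbsTopIII] §1: Theorem 1.9 and Corollary 1.10 (reconstruction signatures)

Mochizuki, *Topics in Absolute Anabelian Geometry III*, §1 pp. 36–45 of the author's manuscript
(lit key `paper:url-5493eb38cbb7`; journal pagination not held): Theorem 1.9 ("The NF-portion
of the Function Field via Belyi Cuspidalization over Sub-p-adic Fields", pp. 36–38; cited ×32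
in [IUTchI–III]), Corollary 1.10 ("Reconstruction of the Function Field for MLF's", pp. 41–44;
×14; = Scholze–Stix 2018, Thm. 7 / Rmk. 9 p. 5), Remarks 1.9.8, 1.10.1–1.10.4.

## Typing policy (plan/FOUNDATIONS.md row 41; the author's own gloss is Rmk. 1.9.8 p. 40:
"We use the term *group-theoretic algorithm* to mean that the algorithm in question is phrased in
language that only depends on the topological group structure of the fundamental group")

Each theorem "there exists a functorial group-theoretic algorithm for reconstructing `T(X)` from
`Π_X`" is typed in three layers:

1. OUTPUT SIGNATURE over the ABSTRACT extension `E : FundamentalExtension` (no curve in sight):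
   a structure whose fields are the objects the printed steps construct (`NFPortion E`,
   `MLFReconstruction E`);
2. ALGORITHM = the "group-theoretic software": an assignment of outputs to ALL abstract inputs
   together with its functoriality (transport along isomorphisms of extensions; the finer
   functoriality in open injective homomorphisms "up to an index factor", Rmk. 1.10.1 (i), is
   recorded in the docstrings only) — `NFPortionAlgorithm`, `MLFReconstructionAlgorithm`;
3. the COMPARISON with scheme theory ("reconstructing the function field of `X`") stated RELATIVE
   TO A MODEL `M : CurveModel` (`CurveModel.lean`; the interface of FOUNDATIONS row 12 — étale
   `π₁` of hyperbolic orbicurves is not in the tree; the intended model is that construction).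
   The NAMED FACTS are therefore predicates `Thm_1_9 M`, `Cor_1_10_i M`, `Cor_1_10_ii M`,
   `Cor_1_10_iii M` on models.  A closed `∃`-statement quantified over "data arising from a
   curve" would be refutable by junk data (a genuine `Π` paired with a wrong field), hence is
   deliberately NOT used.

What is NOT typed here (recorded for the census): the cohomological intermediate steps — Belyi
cuspidalizations (a), the cyclotomes `μ_Ẑ(Π_U)` and synchronizations `I_z ≅ μ_Ẑ(Π_U)` (b), the
subgroups `P_U ⊆ H¹(Π_U, μ_Ẑ(Π_U))` (c) and Kummer containers `lim H¹` (d) of Thm. 1.9, and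
(c), (d'), (f), (g) of Cor. 1.10 — they need continuous cohomology of profinite groups with
`Ẑ(1)`-coefficients and the Kummer map (abc-iut-L2-t3, LLANA N13); they appear below only as
abstract fields (`H1`, `kummer…`, `cycloSync`) of the output signatures, each with its locator.
-/

noncomputable section

open CategoryTheory
open scoped Classical Pointwise

namespace Literature.AnabelianGeometry.AbsoluteAnabelian.AbsTopIII

universe u

namespace CurveModel

variable (M : CurveModel.{u})

/-- The class of inputs of Thm. 1.9: "a hyperbolic orbicurve of strictly Belyi type over a
sub-`p`-adic field `k`, for some prime `p`" (pp. 36–37). [cite: MochizukiAbsTopIII2015, Thm 1.9 p.37] -/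
def IsThm19Input (X : M.Curve) : Prop := M.IsStrictlyBelyiType X ∧ IsSubpadic (M.base X)

/-- The class of inputs of Cor. 1.10: "a hyperbolic orbicurve over an MLF `k`" (p. 41).
[cite: MochizukiAbsTopIII2015, Cor 1.10 p.41] -/
def IsCor110Input (X : M.Curve) : Prop := IsMLF (M.base X)

end CurveModel

/-! ### Theorem 1.9: output signature, algorithm, comparison -/

/-- OUTPUT SIGNATURE of Thm. 1.9 over an abstract extension `E` ("reconstructing the 'NF-portion
of the function field' of `X` from the extension of profinite groups `1 → Δ_X → Π_X → G_k → 1`",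
p. 37): step (e) "the additive structure on `k̄_NF^× ∪ {0}`; `K_{Z_NF}^× ∪ {0}`", i.e. two
fields, the second an algebra over the first; steps (a)–(d) (Belyi cuspidalizations, cyclotomes
`I_z ≅ μ_Ẑ(Π_U)`, `P_U`, the Kummer containers `lim H¹(Π_V, μ_Ẑ(Π_U))`) are represented by the
abstract Kummer container `H1` and the embedding of units into it ((d) "`↪` arises from the Kummer
map"). [cite: MochizukiAbsTopIII2015, Thm 1.9 (e) p.38] -/
structure NFPortion (E : FundamentalExtension.{u}) : Type (u + 1) where
  /-- (a) "by allowing `U` to vary, we obtain a 'group-theoretic' construction of `Π_U` equipped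
  with the collection of subgroups that arise as decomposition groups of NF-points" — here, for
  `U = X` itself: the decomposition groups of NF-points in `Π_X` -/
  nfPointDecomp : Set (Subgroup E.arith)
  /-- (a) the index set of Belyi cuspidalizations `(Y, U)`: "`Y` [...] a finite étale covering of
  `X`; `U ⊆ Y` [...] obtained by removing an arbitrary finite collection of NF-points" -/
  Cover : Type u
  /-- (a) "`Π_U`" for each Belyi cuspidalization -/
  coverExt : Cover → FundamentalExtension.{u}
  /-- (a) "the various surjections `Π_U ↠ Π_Y`" composed with `Π_Y ⊆ Π_X`, as homomorphisms of
  extensions `Π_U → Π_X` -/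
  coverHom : ∀ c, coverExt c ⟶ E
  /-- (e) "`k̄_NF^× ∪ {0}`" with its additive structure: a field -/
  constField : Type u
  /-- field structure of (e) -/
  [instConstField : Field constField]
  /-- (e) "`K_{Z_NF}^× ∪ {0}`" (for `Z` the canonical compactification) with its additive
  structure -/
  functionField : Type u
  /-- field structure of (e) -/
  [instFunctionField : Field functionField]
  /-- (d) "`k̄_NF^× ⊆ K_{Z_NF}^×`" -/
  [instAlgebra : Algebra constField functionField]
  /-- (d) the Kummer container "`lim_V H¹(Π_V, μ_Ẑ(Π_U))`" as an abstract abelian group -/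
  H1 : Type u
  /-- it is an abelian group (written multiplicatively) -/
  [instH1 : CommGroup H1]
  /-- (d) "the '`↪`' arises from the Kummer map": `K_{Z_NF}^× ↪ lim H¹` -/
  kummer : functionFieldˣ →* H1
  /-- the Kummer map is injective (Prop. 1.6 (i)) -/
  kummer_injective : Function.Injective kummer

attribute [instance] NFPortion.instConstField NFPortion.instFunctionField NFPortion.instAlgebra
  NFPortion.instH1

/-- An isomorphism of Thm.-1.9 outputs: isomorphisms of the two fields compatible with the
algebra structure (used to express functoriality). [cite: MochizukiAbsTopIII2015, Thm 1.9 p.38] -/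
structure NFPortion.Iso {E F : FundamentalExtension.{u}} (P : NFPortion E) (Q : NFPortion F) :
    Type u where
  /-- on `k̄_NF` -/
  constEquiv : P.constField ≃+* Q.constField
  /-- on `K_{Z_NF}` -/
  funEquiv : P.functionField ≃+* Q.functionField
  /-- compatibility with `k̄_NF ⊆ K_{Z_NF}` -/
  comm : ∀ c, funEquiv (algebraMap P.constField P.functionField c) =
    algebraMap Q.constField Q.functionField (constEquiv c)

/-- The "functorial group-theoretic ALGORITHM" of Thm. 1.9 as an object: outputs for EVERY
abstract extension (the algorithm "is phrased in language that only depends on the topological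
group structure", Rmk. 1.9.8 p. 40) and transport along isomorphisms of extensions ("the asserted
'functoriality' is with respect to arbitrary open injective homomorphisms of extensions of
profinite groups [...] as well as [...] base-change", p. 38 — only the isomorphism part is typed;
open injections act "up to an index factor", Rmk. 1.10.1 (i) p. 44).
[cite: MochizukiAbsTopIII2015, Thm 1.9 p.37] -/
structure NFPortionAlgorithm : Type (u + 2) where
  /-- the output on an abstract extension -/
  obj : ∀ E : FundamentalExtension.{u}, NFPortion E
  /-- transport along isomorphisms of extensions -/
  map : ∀ {E F : FundamentalExtension.{u}}, (E ≅ F) → (obj E).Iso (obj F)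
  /-- functoriality: identities -/
  map_id : ∀ E, (map (Iso.refl E)).funEquiv = RingEquiv.refl _
  /-- functoriality: composition -/
  map_comp : ∀ {E F K : FundamentalExtension.{u}} (e : E ≅ F) (f : F ≅ K),
    (map (e ≪≫ f)).funEquiv = (map e).funEquiv.trans (map f).funEquiv
  /-- functoriality "with respect to arbitrary open injective homomorphisms of extensions of
  profinite groups" (p. 38; finite étale coverings `Y → X` over finite extensions of the base
  field): the induced embedding of reconstructed function fields, contravariant in `Π_Y ↪ Π_X` -/
  comap : ∀ {E F : FundamentalExtension.{u}} (f : E ⟶ F), f.IsOpenInjective →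
    ((obj F).functionField →+* (obj E).functionField)
  /-- on an isomorphism, `comap` inverts `map` -/
  comap_map : ∀ {E F : FundamentalExtension.{u}} (e : E ≅ F) (h : (e.hom).IsOpenInjective)
    (x : (obj E).functionField), comap e.hom h ((map e).funEquiv x) = x
  /-- functoriality "with respect to homomorphisms of extensions of profinite groups arising from
  a base-change of the base field [i.e., `k`]" (p. 38; `X_{k'} → X`, `Π_{X_{k'}} → Π_X`
  bijective on `Δ`): the induced embedding of reconstructed NF-function fields, contravariant -/
  comapBase : ∀ {E F : FundamentalExtension.{u}} (f : E ⟶ F), f.IsBaseChange →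
    ((obj F).functionField →+* (obj E).functionField)

/-- Thm. 1.9 (comparison form, relative to a model `M`): "there exists a functorial
'group-theoretic' algorithm for reconstructing the 'NF-portion of the function field' of `X`
from the extension of profinite groups `1 → Δ_X → Π_X → G_k → 1`", for `X` "a hyperbolic
orbicurve of strictly Belyi type over a sub-`p`-adic field": some `NFPortionAlgorithm` outputs, on
every such `X` of the model, (a) the decomposition groups of the NF-points of `X` and (d)–(e)
fields isomorphic to `k̄_NF` and `K_{X_NF}`.  NAMED FACT relative to `M` (intended `M` = étale
`π₁`; see the module docstring for why the model parameter is necessary).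
[cite: MochizukiAbsTopIII2015, Thm 1.9 p.37] -/
def Thm_1_9 (M : CurveModel.{u}) : Prop :=
  ∃ A : NFPortionAlgorithm.{u}, ∀ X : M.Curve, M.IsThm19Input X →
    (A.obj (M.ext X)).nfPointDecomp =
        {D | ∃ (x : M.Point X) (g : (M.ext X).arith),
          M.IsNFPoint X x ∧ D = MulAut.conj g • M.decomp X x}
      ∧ Nonempty ((A.obj (M.ext X)).constField ≃+* M.kbarNF X)
      ∧ Nonempty ((A.obj (M.ext X)).functionField ≃+* M.NFFunctionField X)

/-! ### Corollary 1.10: output signature with the LLANA-N9 names, algorithm, comparison -/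

/-- OUTPUT SIGNATURE of Cor. 1.10 over an abstract extension `E` of MLF type ("Reconstruction of
the Function Field for MLF's", pp. 41–44), with the field names consumed by LLANA N9 ("from
`G_v`" / "from `Π_v`"):
(i)(a) the cyclotome `μ_Ẑ(G_k)` and (ii) `μ_Ẑ(Π_X)` as abstract topological abelian groups with
(c) the cyclotomic synchronization `μ_Ẑ(G_k) ≅ μ_Ẑ(Π_X)`; (i)(b) the Frobenius quotient
"`G_k^ab ↠ G^unr ≅ Ẑ`"; (d) the Kummer container `H¹(Π_X, μ_Ẑ(Π_X))` with the image of
"`k^× ↪ H¹(G_k, μ_Ẑ(Π_X)) ↪ H¹(Π_X, μ_Ẑ(Π_X))`"; (iii)(h) the fields `k` ("`k^× ∪ {0}`") and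
`K_X` ("`K_X^× ∪ {0}`"); (e) the decomposition groups of arbitrary closed points.
[cite: MochizukiAbsTopIII2015, Cor 1.10 p.41] -/
structure MLFReconstruction (E : FundamentalExtension.{u}) : Type (u + 1) where
  /-- (i)(a) "`μ_Ẑ(G_k) := Hom(ℚ/ℤ, μ_{ℚ/ℤ}(G_k))`", `μ_{ℚ/ℤ}(G_k) := lim_H (H^ab)_tors` -/
  galCyclotome : Type u
  /-- abelian group structure -/
  [instGalCyclotome : AddCommGroup galCyclotome]
  /-- topology (profinite, `≅ Ẑ`) -/
  [topGalCyclotome : TopologicalSpace galCyclotome]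
  /-- (ii) "`μ_Ẑ(Π_X)` as in Proposition 1.4, (ii); Theorem 1.9, (b)" — LLANA N9 "`Λ`" -/
  arithCyclotome : Type u
  /-- abelian group structure -/
  [instArithCyclotome : AddCommGroup arithCyclotome]
  /-- topology -/
  [topArithCyclotome : TopologicalSpace arithCyclotome]
  /-- (c) "the natural isomorphism `μ_Ẑ(G_k) ≅ μ_Ẑ(Π_X)`" (cyclotomic synchronization,
  Rmk. 1.10.3 (i)) -/
  cycloSync : galCyclotome ≃+ arithCyclotome
  /-- (i)(b) "`G_k^ab ↠ G^unr ≅ Ẑ` determined by the Frobenius element", as a continuous character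
  of `G` to `Ẑ` = Mathlib's profinite completion of `ℤ` -/
  frobQuot : E.gal →ₜ* ProfiniteGrp.ProfiniteCompletion.completion (GrpCat.of (Multiplicative ℤ))
  /-- (d) the Kummer container "`H¹(Π_X, μ_Ẑ(Π_X))`" (multiplicative notation) -/
  H1 : Type u
  /-- abelian group structure -/
  [instH1 : CommGroup H1]
  /-- (iii)(h) "`k^× ∪ {0}`" with "the unique continuous extension of the additive structure":
  the base field `k` — LLANA N9 "`K_v`" -/
  baseField : Type u
  /-- field structure -/
  [instBaseField : Field baseField]
  /-- (d) "the image of the Kummer map `k^× ↪ [...] H¹(Π_X, μ_Ẑ(Π_X))`" -/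
  kummerBase : baseFieldˣ →* H1
  /-- the Kummer map on `k^×` is injective -/
  kummerBase_injective : Function.Injective kummerBase
  /-- (iii)(h) "`K_X^× ∪ {0}`" with its additive structure: the function field `K_X` -/
  functionField : Type u
  /-- field structure -/
  [instFunctionField : Field functionField]
  /-- `k ⊆ K_X` -/
  [instAlgebra : Algebra baseField functionField]
  /-- (iii)(e) "the decomposition groups in `Π_X` of arbitrary closed points of `X`" -/
  closedPointDecomp : Set (Subgroup E.arith)

attribute [instance] MLFReconstruction.instGalCyclotome MLFReconstruction.topGalCyclotome
  MLFReconstruction.instArithCyclotome MLFReconstruction.topArithCyclotome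
  MLFReconstruction.instH1 MLFReconstruction.instBaseField MLFReconstruction.instFunctionField
  MLFReconstruction.instAlgebra

/-- An isomorphism of Cor.-1.10 outputs (for functoriality): field isomorphisms compatible with
`k ⊆ K_X`. [cite: MochizukiAbsTopIII2015, Cor 1.10 p.44] -/
structure MLFReconstruction.Iso {E F : FundamentalExtension.{u}} (P : MLFReconstruction E)
    (Q : MLFReconstruction F) : Type u where
  /-- on `k` -/
  baseEquiv : P.baseField ≃+* Q.baseField
  /-- on `K_X` -/
  funEquiv : P.functionField ≃+* Q.functionField
  /-- compatibility with `k ⊆ K_X` -/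
  comm : ∀ c, funEquiv (algebraMap P.baseField P.functionField c) =
    algebraMap Q.baseField Q.functionField (baseEquiv c)

/-- The "functorial group-theoretic ALGORITHM" of Cor. 1.10 ("from the profinite group `Π_X`
[cf. Remark 1.9.2]", p. 42; "'functoriality' is with respect to arbitrary open injective
homomorphisms of profinite groups", p. 44 — transport along isomorphisms of extensions typed).
[cite: MochizukiAbsTopIII2015, Cor 1.10 p.41] -/
structure MLFReconstructionAlgorithm : Type (u + 2) where
  /-- the output on an abstract extension -/
  obj : ∀ E : FundamentalExtension.{u}, MLFReconstruction E
  /-- transport along isomorphisms of extensions -/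
  map : ∀ {E F : FundamentalExtension.{u}}, (E ≅ F) → (obj E).Iso (obj F)
  /-- functoriality: identities -/
  map_id : ∀ E, (map (Iso.refl E)).funEquiv = RingEquiv.refl _
  /-- functoriality: composition -/
  map_comp : ∀ {E F K : FundamentalExtension.{u}} (e : E ≅ F) (f : F ≅ K),
    (map (e ≪≫ f)).funEquiv = (map e).funEquiv.trans (map f).funEquiv
  /-- functoriality "with respect to arbitrary open injective homomorphisms of profinite groups"
  (p. 44; Rmk. 1.10.1 (i): on the cyclotomes only "up to an index factor", on the fields plain
  functoriality): the induced embedding of reconstructed function fields, contravariant -/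
  comap : ∀ {E F : FundamentalExtension.{u}} (f : E ⟶ F), f.IsOpenInjective →
    ((obj F).functionField →+* (obj E).functionField)
  /-- on an isomorphism, `comap` inverts `map` -/
  comap_map : ∀ {E F : FundamentalExtension.{u}} (e : E ≅ F) (h : (e.hom).IsOpenInjective)
    (x : (obj E).functionField), comap e.hom h ((map e).funEquiv x) = x

/-- Cor. 1.10 (iii) (comparison form, relative to `M`): "Suppose further that `X` is of strictly
Belyi type [...]. Then there exists a functorial 'group-theoretic' algorithm for reconstructing the
function field `K_X` of `X` from the profinite group `Π_X`", steps (e) "the decomposition groups in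
`Π_X` of arbitrary closed points of `X`" and (h) "the additive structure on `k^× ∪ {0}`", "the
additive structure on `K_X^× ∪ {0}`": some `MLFReconstructionAlgorithm` outputs, on every such `X`
of the model, a pair of fields `k ⊆ K_X` isomorphic to `M.base X ⊆ M.FunctionField X`, and its
`closedPointDecomp` is the set of conjugates of the model's decomposition groups of closed points.
This is the statement Scholze–Stix call "Mochizuki's theorem" (SS 2018, Thm. 7 / Rmk. 9 p. 5).
NAMED FACT relative to `M`. [cite: MochizukiAbsTopIII2015, Cor 1.10 (iii) p.43] -/
def Cor_1_10_iii (M : CurveModel.{u}) : Prop :=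
  ∃ A : MLFReconstructionAlgorithm.{u}, ∀ X : M.Curve, M.IsCor110Input X →
    M.IsStrictlyBelyiType X →
      (∃ (eb : (A.obj (M.ext X)).baseField ≃+* M.base X)
          (ef : (A.obj (M.ext X)).functionField ≃+* M.FunctionField X),
          ∀ c, ef (algebraMap _ _ c) = algebraMap (M.base X) (M.FunctionField X) (eb c))
      ∧ (A.obj (M.ext X)).closedPointDecomp =
          {D | ∃ (x : M.Point X) (g : (M.ext X).arith), D = MulAut.conj g • M.decomp X x}

/-- Cor. 1.10 (ii) (comparison form, relative to `M`): over an MLF `k` and for an ARBITRARY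
hyperbolic orbicurve `X/k`, "(d) One constructs the image of the Kummer map
`k^× ↪ H¹(G_k, μ_Ẑ(Π_X)) ↪ H¹(Π_X, μ_Ẑ(Π_X))`" — the unit GROUP `k^×` is reconstructed (the
additive structure on `k^× ∪ {0}` is step (h) of (iii), strictly Belyi type, and is NOT asserted
here): some algorithm's Kummer image `kummerBase (baseFieldˣ)` is, as a group, isomorphic to
`(M.base X)^×`.  NAMED FACT relative to `M` ((a)–(c), the cyclotomes and their synchronization,
are carried as abstract fields; their comparison needs `Ẑ(1)` of `k̄`, not typed here).
[cite: MochizukiAbsTopIII2015, Cor 1.10 (ii) p.42] -/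
def Cor_1_10_ii (M : CurveModel.{u}) : Prop :=
  ∃ A : MLFReconstructionAlgorithm.{u}, ∀ X : M.Curve, M.IsCor110Input X →
    Nonempty ((A.obj (M.ext X)).kummerBase.range ≃* (M.base X)ˣ)

/-- Cor. 1.10 (i)(b) (group-theoretic content, relative to `M`): "the natural surjection
`G_k^ab ↠ G^unr ≅ Ẑ` determined by the Frobenius element in the maximal unramified quotient" is
reconstructed from `G_k` — some algorithm's `frobQuot` is, on every `X` over an MLF, a SURJECTIVE
character `G_k → Ẑ` that is invariant under all automorphisms of the profinite group `G_k` ("may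
be characterized by an entirely group-theoretic algorithm [hence is preserved by isomorphisms]",
Rmk. 1.9.4 p. 38).  NAMED FACT relative to `M`; the identification with the arithmetic Frobenius
needs the unramified quotient of `Gal(k̄/k)` (LCFT file of abc-iut-L4-t4).
[cite: MochizukiAbsTopIII2015, Cor 1.10 (i) p.42] -/
def Cor_1_10_i (M : CurveModel.{u}) : Prop :=
  ∃ A : MLFReconstructionAlgorithm.{u}, ∀ X : M.Curve, M.IsCor110Input X →
    Function.Surjective (A.obj (M.ext X)).frobQuot
      ∧ ∀ (φ : (M.ext X).gal ≃ₜ* (M.ext X).gal) (g : (M.ext X).gal),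
          (A.obj (M.ext X)).frobQuot (φ g) = (A.obj (M.ext X)).frobQuot g

/-! ### Proposition 1.6, Proposition 1.8, Remarks 1.9.1–1.9.9 (records; NOT typed as decls)

* Prop. 1.6 (Kummer Classes of Rational Functions) pp. 34–35 — "(i) The Kummer map
  `κ_U : Γ(U, 𝒪_U^×) → H¹(Π_U, M_X)` is injective. (ii) [...] `t_D : G_k → Π_J` coincides [...]
  with the section determined by the identity element `∈ J(k)` if and only if the divisor `D` is
  principal. (iii) [...] a natural exact sequence `1 → (k^×)^∧ → H¹(Π_U, M_X) → ⊕_{x ∈ S} Ẑ`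
  [...] the image of `Γ(U, 𝒪_U^×)` in `H¹(Π_U, M_X)/(k^×)^∧` is equal to the inverse image [...]
  of the submodule of `⊕_{x ∈ S} ℤ` determined by the principal divisors" — and Prop. 1.8
  (Characterization of NF-Constants and NF-Rational Functions) p. 36, (i) "`η ∈ P_U` is the
  Kummer class of a nonconstant NF-rational function if and only if there exist a positive
  multiple `η†` of `η` and NF-points `x₁, x₂` [...] such that `η†|_{x₁} = 0`, `η†|_{x₂} ≠ 0`",
  (ii) the analogous characterization of NF-constants: typed in `CuspidalCyclotome.lean` over a
  REAL `H¹(Π_U, M_X)` (Mathlib continuous cohomology of the group-theoretic cyclotome of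
  Prop. 1.4 (ii)) relative to a model carrying the Kummer map — Prop. 1.6 (i) in full,
  Prop. 1.6 (iii) and Prop. 1.8 (i), (ii) PARTIALLY (for Kummer classes of regular units; the
  subgroup `P_U` and `(k^×)^∧` need the synchronizations `I_z ≅ M_X` for all cusps); Prop. 1.6
  (ii) (sections `t_D : G_k → Π_{J^d}`, Picard schemes) remains a deferred node.
* Rmk. 1.9.1 p. 38: "When `k` is an MLF [...] one may give a tempered version of Theorem 1.9
  [...] in which [...] `Π_X` is replaced by the tempered fundamental group" — the tempered
  interface is abc-iut-L3-t2's (`toProfinite : FundamentalExtension`); record.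
* Rmk. 1.9.2: typed in `CurveModel.lean` (`CurveModel.Rmk_1_9_2`).
* Rmk. 1.9.3 p. 38: "the algorithm of Theorem 1.9 does not furnish a means for reconstructing
  `k`, `K_Z` in general" — a non-claim; record.
* Rmk. 1.9.4 pp. 38–39: `G_k` of an MLF "has one rigid dimension and one non-rigid dimension"
  (the Frobenius element of `G_k ↠ G_k^unr ≅ Ẑ` is group-theoretic — this is the invariance
  clause of `Cor_1_10_i`; there exist isomorphisms of absolute Galois groups of MLF's that are
  not "geometric", [NSW] / [AbsTopI] Cor. 3.7) — the existence of non-geometric isomorphisms is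
  abc-iut-L4-t4's [AbsTopI] item; record.
* Rmk. 1.9.5 (i)–(ii) pp. 39–40 (a new proof of a consequence of Neukirch–Uchida, independent of
  the "global address" of primes), Rmk. 1.9.6 p. 40 (configuration spaces, "routine details"
  left to the reader), Rmk. 1.9.7 p. 40 ("complete 'combinatorialization' — independent of the
  base field"), Rmk. 1.9.8 pp. 40–41 (the mono- versus bi-anabelian gloss = this file's typing policy,
  quoted in the module docstring), Rmk. 1.9.9 p. 41 (M. Kim's suggestion: characterize the `Π`
  that occur as `Π_X`): discussion; no decls.
-/

/-! ### Remarks 1.10.1–1.10.4 (records)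

* Rmk. 1.10.1 (i)–(iii) p. 44: functoriality of Thm. 1.9 / Cor. 1.10 under passage to open
  subgroups is "a 'compatibility', relative to dividing the usual functorially induced morphism
  on '`μ_Ẑ(Π_X)`'s' by a factor given by the index"; (ii) "`μ_Ẑ(Π_U)`" for orbicurves by passing
  to coverings; (iii) the same for `H²(G_k, μ_Ẑ(G_k)) ≅ Ẑ` — recorded; the algorithms above type
  transport along ISOMORPHISMS only (index factor `1`).
* Rmk. 1.10.2 p. 45: "one may give a tempered version of Corollary 1.10" (cf. Rmk. 1.9.1) — the
  tempered interface is abc-iut-L3-t2's; record only.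
* Rmk. 1.10.3 (i)–(ii) p. 45: (c) is "a sort of synchronization of [arithmetic and geometric]
  cyclotomes" (the field `MLFReconstruction.cycloSync`); (ii) the further isomorphisms
  `G_k^ab ≅ H¹(G_k, μ_Ẑ(Π_X))` and `μ_Ẑ(G_k) ≅ μ^κ_Ẑ(Π_X) := Hom(ℚ/ℤ, κ(k̄_NF^×))` — not typed
  (cohomological).
* Rmk. 1.10.4 p. 45: a misprint correction to [Mzk19] Thm. 1.1 (iii) — no mathematical content
  for this tree.
-/

end Literature.AnabelianGeometry.AbsoluteAnabelian.AbsTopIII
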